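import Summits.PneNP.PneNP.Theorems.ConvexRankGatesConvexGateBlindExactLiftingTrianglePairSplit
import Summits.PneNP.PneNP.Theorems.ConvexRankGatesConvexGateBlindExactLiftingTriangleLineSpread

/-!
# Triangle instance — peeling an interaction-free atom to line-free normal form (lead c6, THEOREM C√ step F6)

Support file for crux `ConvexGateBlind` (stmt-PneNP-10680), line `xor-door-perfect-completeness`, open stub
`stub_exactLifting`; part of the Lean route to THEOREM C√ (memo `THEOREM-C-sqrt.md` on the item).

* §1 Scaled lines of the three directions are two-directional, so subtracting them never decreases heaviness
  (`monoHeavy_sub_line2/3`, the first direction is `monoHeavy_sub_line` of `…TriangleLineSpread`).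
* §2 **Peeling** (`exists_lineFree_peeling`): every non-negative interaction-free `v` has a non-negative
  interaction-free LINE-FREE `R` (every line contains a zero of `R`) with `heavySet v ⊆ heavySet R` and
  `mass R ≤ mass v`.  Proof: strong induction on the number of lines without a zero; subtract the minimum of `v` on
  such a line times its indicator — zeros persist (values only decrease and stay `≥ 0`), one more line gets a zero.
* (sequel `…TriangleMarginalSpread`: for a line-free non-negative interaction-free `R`, every line carries at most
  `3·mass/t`, hence `t·Σ marg² ≤ 3·mass²` for the three line-mass marginals.)

Nothing here is cited; everything is elementary.
-/

set_option linter.dupNamespace false -- `Summit.PneNP.PneNP.…`: summit = sub-problem (D-0017)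

namespace Summit.PneNP.PneNP.Theorems.XorDoor.TriLine.Heavy

open Finset Classical

noncomputable section

variable {t : ℕ}

/-! ## §1 Scaled lines in the other two directions -/

/-- the indicator of the line `{(a, ·, d)}` scaled by `c` -/
def lineFun2 (c : ℝ) (a d : Fin t) : Tri t → ℝ := fun w => if w.1 = a ∧ w.2.2 = d then c else 0

/-- the indicator of the line `{(a, b, ·)}` scaled by `c` -/
def lineFun3 (c : ℝ) (a b : Fin t) : Tri t → ℝ := fun w => if w.1 = a ∧ w.2.1 = b then c else 0

/-- a scaled line of the second direction is two-directional (shared `a`: `f = 0`, `h a' d' = c·[a'=a][d'=d]`) -/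
lemma twoDir_lineFun2 (c : ℝ) (a d : Fin t) : TwoDir (lineFun2 c a d) :=
  Or.inl ⟨fun _ _ => 0, fun a' d' => if a' = a ∧ d' = d then c else 0, fun a' b' d' => by simp [lineFun2]⟩

/-- a scaled line of the third direction is two-directional (shared `a`: `f a' b' = c·[a'=a][b'=b]`, `h = 0`) -/
lemma twoDir_lineFun3 (c : ℝ) (a b : Fin t) : TwoDir (lineFun3 c a b) :=
  Or.inl ⟨fun a' b' => if a' = a ∧ b' = b then c else 0, fun _ _ => 0, fun a' b' d' => by simp [lineFun3]⟩

/-- peeling a line of the second direction keeps heavy rows -/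
theorem monoHeavy_sub_line2 {x : Col t} (hx : Balanced x) (v : Tri t → ℝ) {c : ℝ} (hc : 0 ≤ c) (a d : Fin t)
    (hv : MonoHeavy x v) : MonoHeavy x (fun w => v w - lineFun2 c a d w) := by
  have hlin : heav x (fun w => v w - lineFun2 c a d w) = heav x v - heav x (lineFun2 c a d) := by
    simp only [heav, mul_sub, sum_sub_distrib]
  have hle : heav x (lineFun2 c a d) ≤ 0 :=
    heav_nonpos_of_twoDir hx (fun w => by simp only [lineFun2]; split_ifs <;> linarith) (twoDir_lineFun2 c a d)
  unfold MonoHeavy at hv ⊢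
  linarith

/-- peeling a line of the third direction keeps heavy rows -/
theorem monoHeavy_sub_line3 {x : Col t} (hx : Balanced x) (v : Tri t → ℝ) {c : ℝ} (hc : 0 ≤ c) (a b : Fin t)
    (hv : MonoHeavy x v) : MonoHeavy x (fun w => v w - lineFun3 c a b w) := by
  have hlin : heav x (fun w => v w - lineFun3 c a b w) = heav x v - heav x (lineFun3 c a b) := by
    simp only [heav, mul_sub, sum_sub_distrib]
  have hle : heav x (lineFun3 c a b) ≤ 0 :=
    heav_nonpos_of_twoDir hx (fun w => by simp only [lineFun3]; split_ifs <;> linarith) (twoDir_lineFun3 c a b)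
  unfold MonoHeavy at hv ⊢
  linarith

/-- heavy sets grow under peeling (any of the three directions, `c ≥ 0`) -/
lemma heavySet_subset_of_sub {v v' : Tri t → ℝ}
    (h : ∀ x : Col t, Balanced x → MonoHeavy x v → MonoHeavy x v') : heavySet v ⊆ heavySet v' := by
  intro x hx
  rw [mem_heavySet] at hx ⊢
  exact ⟨hx.1, h x hx.1 hx.2⟩

/-! ## §2 Peeling to line-free normal form -/

/-- the number of lines WITHOUT a zero of `v` -/
def badCount (v : Tri t → ℝ) : ℕ :=
  #(univ.filter fun p : Fin t × Fin t => ∀ a, v (a, p.1, p.2) ≠ 0) +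
  #(univ.filter fun p : Fin t × Fin t => ∀ b, v (p.1, b, p.2) ≠ 0) +
  #(univ.filter fun p : Fin t × Fin t => ∀ d, v (p.1, p.2, d) ≠ 0)

/-- no bad line means line-free -/
lemma lineFree_of_badCount_eq_zero {v : Tri t → ℝ} (h : badCount v = 0) : LineFree v := by
  unfold badCount at h
  have h1 : #(univ.filter fun p : Fin t × Fin t => ∀ a, v (a, p.1, p.2) ≠ 0) = 0 := by omega
  have h2 : #(univ.filter fun p : Fin t × Fin t => ∀ b, v (p.1, b, p.2) ≠ 0) = 0 := by omega
  have h3 : #(univ.filter fun p : Fin t × Fin t => ∀ d, v (p.1, p.2, d) ≠ 0) = 0 := by omega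
  rw [card_eq_zero, filter_eq_empty_iff] at h1 h2 h3
  refine ⟨fun b d => ?_, fun a d => ?_, fun a b => ?_⟩
  · obtain ⟨a, ha⟩ := not_forall.mp (h1 (x := (b, d)) (mem_univ _)); exact ⟨a, not_not.mp ha⟩
  · obtain ⟨b, hb⟩ := not_forall.mp (h2 (x := (a, d)) (mem_univ _)); exact ⟨b, not_not.mp hb⟩
  · obtain ⟨d, hd⟩ := not_forall.mp (h3 (x := (a, b)) (mem_univ _)); exact ⟨d, not_not.mp hd⟩

/-- a zero of a non-negative `v` stays a zero after subtracting something non-negative pointwise dominated by `v` -/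
lemma zero_persists {v g : Tri t → ℝ} (hg : ∀ w, 0 ≤ g w) (hdom : ∀ w, g w ≤ v w) {w : Tri t} (h0 : v w = 0) :
    v w - g w = 0 := by
  have := hdom w; have := hg w; linarith

/-- the "bad" filters can only shrink under such a subtraction -/
lemma badFilter1_subset {v g : Tri t → ℝ} (hg : ∀ w, 0 ≤ g w) (hdom : ∀ w, g w ≤ v w) :
    (univ.filter fun p : Fin t × Fin t => ∀ a, v (a, p.1, p.2) - g (a, p.1, p.2) ≠ 0)
      ⊆ (univ.filter fun p : Fin t × Fin t => ∀ a, v (a, p.1, p.2) ≠ 0) := by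
  intro p hp
  simp only [mem_filter, mem_univ, true_and] at hp ⊢
  intro a h0
  exact hp a (zero_persists hg hdom h0)

/-- second direction -/
lemma badFilter2_subset {v g : Tri t → ℝ} (hg : ∀ w, 0 ≤ g w) (hdom : ∀ w, g w ≤ v w) :
    (univ.filter fun p : Fin t × Fin t => ∀ b, v (p.1, b, p.2) - g (p.1, b, p.2) ≠ 0)
      ⊆ (univ.filter fun p : Fin t × Fin t => ∀ b, v (p.1, b, p.2) ≠ 0) := by
  intro p hp
  simp only [mem_filter, mem_univ, true_and] at hp ⊢
  intro b h0
  exact hp b (zero_persists hg hdom h0)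

/-- third direction -/
lemma badFilter3_subset {v g : Tri t → ℝ} (hg : ∀ w, 0 ≤ g w) (hdom : ∀ w, g w ≤ v w) :
    (univ.filter fun p : Fin t × Fin t => ∀ d, v (p.1, p.2, d) - g (p.1, p.2, d) ≠ 0)
      ⊆ (univ.filter fun p : Fin t × Fin t => ∀ d, v (p.1, p.2, d) ≠ 0) := by
  intro p hp
  simp only [mem_filter, mem_univ, true_and] at hp ⊢
  intro d h0
  exact hp d (zero_persists hg hdom h0)

/-- the induction invariant package of an atom -/
structure Good (v : Tri t → ℝ) : Prop where
  nonneg : ∀ w, 0 ≤ v w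
  intFree : InteractionFree v

/-- **One peeling step**: if some line has no zero, subtracting the minimum of `v` on it (times the line indicator)
keeps the invariants, keeps heavy rows, does not increase the mass, and lowers `badCount`. -/
lemma peel_step {v : Tri t → ℝ} (hv : Good v) (hbad : 0 < badCount v) :
    ∃ v' : Tri t → ℝ, Good v' ∧ heavySet v ⊆ heavySet v' ∧ mass v' ≤ mass v ∧ badCount v' < badCount v := by
  obtain ⟨f, g, h, hfgh⟩ := hv.intFree
  -- locate a bad line in one of the three directions
  have hcases : (univ.filter fun p : Fin t × Fin t => ∀ a, v (a, p.1, p.2) ≠ 0).Nonempty ∨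
      (univ.filter fun p : Fin t × Fin t => ∀ b, v (p.1, b, p.2) ≠ 0).Nonempty ∨
      (univ.filter fun p : Fin t × Fin t => ∀ d, v (p.1, p.2, d) ≠ 0).Nonempty := by
    by_contra hcon
    simp only [not_or, not_nonempty_iff_eq_empty] at hcon
    unfold badCount at hbad
    rw [hcon.1, hcon.2.1, hcon.2.2] at hbad
    simp at hbad
  rcases hcases with ⟨p, hp⟩ | ⟨p, hp⟩ | ⟨p, hp⟩
  · -- direction 1: the line `{(·, p.1, p.2)}`
    simp only [mem_filter, mem_univ, true_and] at hp
    have hne : (univ : Finset (Fin t)).Nonempty := by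
      by_contra hcon
      rw [not_nonempty_iff_eq_empty, univ_eq_empty_iff] at hcon
      -- no `a` at all: the line condition is vacuous but then the filter element gives nothing to subtract;
      -- yet `Fin t` empty forces `t = 0`, and then `Fin t × Fin t` is empty too, contradicting `p`
      exact hcon.elim p.1
    obtain ⟨a₀, -, hmin⟩ := exists_min_image univ (fun a => v (a, p.1, p.2)) hne
    set c := v (a₀, p.1, p.2) with hc
    have hcnn : 0 ≤ c := hv.nonneg _
    let g₁ : Tri t → ℝ := lineFun1 c p.1 p.2
    have hg₁ : ∀ w, 0 ≤ g₁ w := fun w => by simp only [g₁, lineFun1]; split_ifs <;> linarith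
    have hdom : ∀ w, g₁ w ≤ v w := by
      intro w
      simp only [g₁, lineFun1]
      split_ifs with hw
      · obtain ⟨hb, hd⟩ := hw
        have := hmin w.1 (mem_univ _)
        have hw' : w = (w.1, p.1, p.2) := by ext <;> simp [hb, hd]
        rw [hw']; exact this
      · exact hv.nonneg w
    refine ⟨fun w => v w - g₁ w, ⟨fun w => by linarith [hdom w], ?_⟩, ?_, ?_, ?_⟩
    · refine ⟨f, fun b d => g b d - (if b = p.1 ∧ d = p.2 then c else 0), h, fun a b d => ?_⟩
      simp only [g₁, lineFun1, hfgh]; ring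
    · exact heavySet_subset_of_sub fun x hx hh => monoHeavy_sub_line hx v hcnn p.1 p.2 hh
    · simp only [mass, sum_sub_distrib]
      linarith [sum_nonneg fun w (_ : w ∈ (univ : Finset (Tri t))) => hg₁ w]
    · -- the first bad filter loses `p`; none gains
      have hsub1 := badFilter1_subset (v := v) hg₁ hdom
      have hsub2 := badFilter2_subset (v := v) hg₁ hdom
      have hsub3 := badFilter3_subset (v := v) hg₁ hdom
      have hnot : p ∉ (univ.filter fun q : Fin t × Fin t => ∀ a, v (a, q.1, q.2) - g₁ (a, q.1, q.2) ≠ 0) := by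
        simp only [mem_filter, mem_univ, true_and, not_forall, not_not]
        refine ⟨a₀, ?_⟩
        simp [g₁, lineFun1, hc]
      have hin : p ∈ (univ.filter fun q : Fin t × Fin t => ∀ a, v (a, q.1, q.2) ≠ 0) := by
        simp only [mem_filter, mem_univ, true_and]; exact hp
      have hlt := card_lt_card (Finset.ssubset_iff_subset_ne.2 ⟨hsub1, fun heq => hnot (heq ▸ hin)⟩)
      have hle2 := card_le_card hsub2
      have hle3 := card_le_card hsub3
      unfold badCount
      beta_reduce
      omega
  · -- direction 2: the line `{(p.1, ·, p.2)}`
    simp only [mem_filter, mem_univ, true_and] at hp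
    have hne : (univ : Finset (Fin t)).Nonempty := by
      by_contra hcon
      rw [not_nonempty_iff_eq_empty, univ_eq_empty_iff] at hcon
      exact hcon.elim p.1
    obtain ⟨b₀, -, hmin⟩ := exists_min_image univ (fun b => v (p.1, b, p.2)) hne
    set c := v (p.1, b₀, p.2) with hc
    have hcnn : 0 ≤ c := hv.nonneg _
    let g₁ : Tri t → ℝ := lineFun2 c p.1 p.2
    have hg₁ : ∀ w, 0 ≤ g₁ w := fun w => by simp only [g₁, lineFun2]; split_ifs <;> linarith
    have hdom : ∀ w, g₁ w ≤ v w := by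
      intro w
      simp only [g₁, lineFun2]
      split_ifs with hw
      · obtain ⟨ha, hd⟩ := hw
        have := hmin w.2.1 (mem_univ _)
        have hw' : w = (p.1, w.2.1, p.2) := by ext <;> simp [ha, hd]
        rw [hw']; exact this
      · exact hv.nonneg w
    refine ⟨fun w => v w - g₁ w, ⟨fun w => by linarith [hdom w], ?_⟩, ?_, ?_, ?_⟩
    · refine ⟨f, g, fun a d => h a d - (if a = p.1 ∧ d = p.2 then c else 0), fun a b d => ?_⟩
      simp only [g₁, lineFun2, hfgh]; ring
    · exact heavySet_subset_of_sub fun x hx hh => monoHeavy_sub_line2 hx v hcnn p.1 p.2 hh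
    · simp only [mass, sum_sub_distrib]
      linarith [sum_nonneg fun w (_ : w ∈ (univ : Finset (Tri t))) => hg₁ w]
    · have hsub1 := badFilter1_subset (v := v) hg₁ hdom
      have hsub2 := badFilter2_subset (v := v) hg₁ hdom
      have hsub3 := badFilter3_subset (v := v) hg₁ hdom
      have hnot : p ∉ (univ.filter fun q : Fin t × Fin t => ∀ b, v (q.1, b, q.2) - g₁ (q.1, b, q.2) ≠ 0) := by
        simp only [mem_filter, mem_univ, true_and, not_forall, not_not]
        refine ⟨b₀, ?_⟩
        simp [g₁, lineFun2, hc]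
      have hin : p ∈ (univ.filter fun q : Fin t × Fin t => ∀ b, v (q.1, b, q.2) ≠ 0) := by
        simp only [mem_filter, mem_univ, true_and]; exact hp
      have hlt := card_lt_card (Finset.ssubset_iff_subset_ne.2 ⟨hsub2, fun heq => hnot (heq ▸ hin)⟩)
      have hle1 := card_le_card hsub1
      have hle3 := card_le_card hsub3
      unfold badCount
      beta_reduce
      omega
  · -- direction 3: the line `{(p.1, p.2, ·)}`
    simp only [mem_filter, mem_univ, true_and] at hp
    have hne : (univ : Finset (Fin t)).Nonempty := by
      by_contra hcon
      rw [not_nonempty_iff_eq_empty, univ_eq_empty_iff] at hcon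
      exact hcon.elim p.1
    obtain ⟨d₀, -, hmin⟩ := exists_min_image univ (fun d => v (p.1, p.2, d)) hne
    set c := v (p.1, p.2, d₀) with hc
    have hcnn : 0 ≤ c := hv.nonneg _
    let g₁ : Tri t → ℝ := lineFun3 c p.1 p.2
    have hg₁ : ∀ w, 0 ≤ g₁ w := fun w => by simp only [g₁, lineFun3]; split_ifs <;> linarith
    have hdom : ∀ w, g₁ w ≤ v w := by
      intro w
      simp only [g₁, lineFun3]
      split_ifs with hw
      · obtain ⟨ha, hb⟩ := hw
        have := hmin w.2.2 (mem_univ _)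
        have hw' : w = (p.1, p.2, w.2.2) := by ext <;> simp [ha, hb]
        rw [hw']; exact this
      · exact hv.nonneg w
    refine ⟨fun w => v w - g₁ w, ⟨fun w => by linarith [hdom w], ?_⟩, ?_, ?_, ?_⟩
    · refine ⟨fun a b => f a b - (if a = p.1 ∧ b = p.2 then c else 0), g, h, fun a b d => ?_⟩
      simp only [g₁, lineFun3, hfgh]; ring
    · exact heavySet_subset_of_sub fun x hx hh => monoHeavy_sub_line3 hx v hcnn p.1 p.2 hh
    · simp only [mass, sum_sub_distrib]
      linarith [sum_nonneg fun w (_ : w ∈ (univ : Finset (Tri t))) => hg₁ w]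
    · have hsub1 := badFilter1_subset (v := v) hg₁ hdom
      have hsub2 := badFilter2_subset (v := v) hg₁ hdom
      have hsub3 := badFilter3_subset (v := v) hg₁ hdom
      have hnot : p ∉ (univ.filter fun q : Fin t × Fin t => ∀ d, v (q.1, q.2, d) - g₁ (q.1, q.2, d) ≠ 0) := by
        simp only [mem_filter, mem_univ, true_and, not_forall, not_not]
        refine ⟨d₀, ?_⟩
        simp [g₁, lineFun3, hc]
      have hin : p ∈ (univ.filter fun q : Fin t × Fin t => ∀ d, v (q.1, q.2, d) ≠ 0) := by
        simp only [mem_filter, mem_univ, true_and]; exact hp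
      have hlt := card_lt_card (Finset.ssubset_iff_subset_ne.2 ⟨hsub3, fun heq => hnot (heq ▸ hin)⟩)
      have hle1 := card_le_card hsub1
      have hle2 := card_le_card hsub2
      unfold badCount
      beta_reduce
      omega

/-- **Peeling to line-free normal form.**  Every non-negative interaction-free atom has a non-negative
interaction-free LINE-FREE atom with a larger heavy set and no larger mass. -/
theorem exists_lineFree_peeling {v : Tri t → ℝ} (hnn : ∀ w, 0 ≤ v w) (hIF : InteractionFree v) :
    ∃ R : Tri t → ℝ, (∀ w, 0 ≤ R w) ∧ InteractionFree R ∧ LineFree R ∧ heavySet v ⊆ heavySet R ∧ mass R ≤ mass v := by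
  suffices H : ∀ n : ℕ, ∀ v : Tri t → ℝ, badCount v = n → Good v →
      ∃ R : Tri t → ℝ, Good R ∧ LineFree R ∧ heavySet v ⊆ heavySet R ∧ mass R ≤ mass v by
    obtain ⟨R, hR, hlf, hsub, hm⟩ := H _ v rfl ⟨hnn, hIF⟩
    exact ⟨R, hR.nonneg, hR.intFree, hlf, hsub, hm⟩
  intro n
  induction n using Nat.strong_induction_on with
  | _ n ih =>
    intro v hn hv
    rcases Nat.eq_zero_or_pos n with h0 | hpos
    · exact ⟨v, hv, lineFree_of_badCount_eq_zero (hn.trans h0), subset_rfl, le_rfl⟩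
    · obtain ⟨v', hv', hsub, hm, hlt⟩ := peel_step hv (hn ▸ hpos)
      obtain ⟨R, hR, hlf, hsub', hm'⟩ := ih (badCount v') (hn ▸ hlt) v' rfl hv'
      exact ⟨R, hR, hlf, hsub.trans hsub', hm'.trans hm⟩

/-- **Peeling, registered form** (sub-goal `triangle_peeling` of stmt-PneNP-10680): line-free normal form of a
non-negative interaction-free atom, with larger heavy set and no larger mass. -/
theorem triangle_peeling : ∀ {t : ℕ} {v : Tri t → ℝ}, (∀ w, 0 ≤ v w) → InteractionFree v → ∃ R : Tri t → ℝ, (∀ w, 0 ≤ R w) ∧ InteractionFree R ∧ LineFree R ∧ heavySet v ⊆ heavySet R ∧ mass R ≤ mass v :=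
  fun hnn hIF => exists_lineFree_peeling hnn hIF

end

end Summit.PneNP.PneNP.Theorems.XorDoor.TriLine.Heavy
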